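import Mathlib
import Summits.QuantumFields.YangMills.Theses.AspectPurityFloor
import Summits.QuantumFields.YangMills.Theorems.AspectPurityFloorParticipationDoor
import Summits.QuantumFields.YangMills.Theorems.ThermalTraceWindowSubFemtoFirstLevelRungFixedL
import HarnessLib

/-!
# Route `AspectPurityFloor` (planner ym-idea-4 g19), item ⟨stmt-QuantumFields-23744⟩ `SmallToriEntropy` — CLOSED

`smallToriEntropy_proof : Summit.QuantumFields.YangMills.Theses.AspectPurityFloor.SmallToriEntropy`: for every `L₀` there are `C, q, β₁`
with `Z_phys(L×L³) ≤ (1 + C β^q √((λ₁/λ₀)^L)) λ₀^L` for all `β ≥ β₁`, `2 ≤ L ≤ L₀`.  A finite maximum over `L ≤ L₀` of the two landed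
fixed-lattice rungs: `physTrace_le_poly_mul_levelValue_zero_pow_of_le` (`Z ≤ C_L β^{q_L} λ₀^L`, `β ≥ 1`) and
`subFemtoFirstLevel_rung_fixedL` (`β^{−k_L} λ₀^L ≤ λ₁^L`, so `1 ≤ β^{k_L/2} √((λ₁/λ₀)^L)`); constants are merged by crude sums over
`L < L₀ + 1` (`C = Σ C_L`, `q = Σ (|q_L| + |k_L|)`, `β₁ = 1 + Σ |β_L|`).
HONEST FRAMING: support bookkeeping; the cruxes, K1a, R2ξ″ and the YM mass gap are NOT proved.  No `sorry`, no new axiom, no new definition.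
References: [cite: Luscher1983, §2]; [cite: MontvayMunster1994, (3.145)].
-/

set_option autoImplicit false

noncomputable section

open scoped BigOperators

namespace Summit.QuantumFields.YangMills.Theorems.AspectPurityFloor

open Summit.QuantumFields.YangMills.Theorems.FemtoTransferGap
open Summit.QuantumFields.YangMills.Theses.AspectPurityFloor (physTrace_le_poly_mul_levelValue_zero_pow_of_le)
open Summit.QuantumFields.YangMills.Theses.ThermalTraceWindow (subFemtoFirstLevel_rung_fixedL)

/-- ★★★ **`AspectPurityFloor.SmallToriEntropy`** ⟨stmt-QuantumFields-23744⟩. [cite: Luscher1983, §2] [cite: MontvayMunster1994, (3.145)] -/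
theorem smallToriEntropy_proof : Summit.QuantumFields.YangMills.Theses.AspectPurityFloor.SmallToriEntropy := by
  intro L₀
  classical
  -- per-size constants, indexed by `n` with `L = n + 1`
  choose C q hC hZ using fun n : ℕ => physTrace_le_poly_mul_levelValue_zero_pow_of_le (n + 1)
  choose k b hk using fun n : ℕ => subFemtoFirstLevel_rung_fixedL (n + 1)
  set S : Finset ℕ := Finset.range (L₀ + 1) with hS
  refine ⟨∑ n ∈ S, C n, ∑ n ∈ S, (|q n| + |k n|), 1 + ∑ n ∈ S, |b n|,
    Finset.sum_pos (fun n _ => hC n) ⟨0, by simp [hS]⟩, fun β hβ L _ hL2 hLL₀ => ?_⟩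
  obtain ⟨n, rfl⟩ : ∃ n, L = n + 1 := ⟨L - 1, by omega⟩
  have hn : n ∈ S := by rw [hS, Finset.mem_range]; omega
  have hβ1 : (1 : ℝ) ≤ β := by
    have : 0 ≤ ∑ m ∈ S, |b m| := Finset.sum_nonneg fun m _ => abs_nonneg _
    linarith
  have hβ0 : 0 < β := by linarith
  have hβb : b n ≤ β := by
    have : |b n| ≤ ∑ m ∈ S, |b m| := Finset.single_le_sum (fun m _ => abs_nonneg (b m)) hn
    linarith [le_abs_self (b n)]
  -- the two rungs at this size
  have h1 : TT.physTrace (n + 1) β (n + 1) ≤ C n * β ^ q n * levelValue su2Rep (n + 1) β 0 ^ (n + 1) :=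
    hZ n (n + 1) (by omega) β hβ1
  have h2 : β ^ (-k n) * levelValue su2Rep (n + 1) β 0 ^ (n + 1) ≤ levelValue su2Rep (n + 1) β 1 ^ (n + 1) := hk n β hβb
  set lam0 := levelValue su2Rep (n + 1) β 0 with hlam0
  set lam1 := levelValue su2Rep (n + 1) β 1 with hlam1
  have hlam0pos : 0 < lam0 := levelValue_zero_su2Rep_pos (n + 1) β
  have hpow0 : 0 < lam0 ^ (n + 1) := pow_pos hlam0pos _
  -- `1 ≤ β^{k} · (λ₁/λ₀)^L`, hence `1 ≤ β^{k/2... }`: we use `β^{-k} ≤ (λ₁/λ₀)^L` and `√x ≥ x` for `x ≤ 1`? no — use `√((λ₁/λ₀)^L) ≥ β^{-k/2}`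
  have hratio : β ^ (-k n) ≤ (lam1 / lam0) ^ (n + 1) := by
    rw [div_pow, le_div_iff₀ hpow0]; exact h2
  have hsqrt : β ^ (-(k n) / 2) ≤ Real.sqrt ((lam1 / lam0) ^ (n + 1)) := by
    have : β ^ (-(k n) / 2) = Real.sqrt (β ^ (-k n)) := by
      rw [Real.sqrt_eq_rpow, ← Real.rpow_mul hβ0.le]; ring_nf
    rw [this]; exact Real.sqrt_le_sqrt hratio
  -- assemble: `C_n β^{q_n} = C_n β^{q_n + k_n/2} β^{-k_n/2} ≤ C_n β^{q_n + k_n/2} √r ≤ C β^q √r`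
  have hq : q n + k n / 2 ≤ ∑ m ∈ S, (|q m| + |k m|) := by
    have : |q n| + |k n| ≤ ∑ m ∈ S, (|q m| + |k m|) :=
      Finset.single_le_sum (fun m _ => add_nonneg (abs_nonneg (q m)) (abs_nonneg (k m))) hn
    have hk' : k n / 2 ≤ |k n| := by have := le_abs_self (k n); have := abs_nonneg (k n); linarith
    linarith [le_abs_self (q n)]
  have hCle : C n ≤ ∑ m ∈ S, C m := Finset.single_le_sum (fun m _ => (hC m).le) hn
  have hr0 : 0 ≤ Real.sqrt ((lam1 / lam0) ^ (n + 1)) := Real.sqrt_nonneg _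
  have hstep : C n * β ^ q n ≤ (∑ m ∈ S, C m) * β ^ (∑ m ∈ S, (|q m| + |k m|)) * Real.sqrt ((lam1 / lam0) ^ (n + 1)) := by
    have e : β ^ q n = β ^ (q n + k n / 2) * β ^ (-(k n) / 2) := by
      rw [← Real.rpow_add hβ0]; ring_nf
    rw [e, ← mul_assoc]
    have hA : C n * β ^ (q n + k n / 2) ≤ (∑ m ∈ S, C m) * β ^ (∑ m ∈ S, (|q m| + |k m|)) :=
      mul_le_mul hCle (Real.rpow_le_rpow_of_exponent_le hβ1 hq) (Real.rpow_nonneg hβ0.le _)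
        (Finset.sum_nonneg fun m _ => (hC m).le)
    exact mul_le_mul hA hsqrt (Real.rpow_nonneg hβ0.le _)
      (mul_nonneg (Finset.sum_nonneg fun m _ => (hC m).le) (Real.rpow_nonneg hβ0.le _))
  calc TT.physTrace (n + 1) β (n + 1) ≤ C n * β ^ q n * lam0 ^ (n + 1) := h1
    _ ≤ (∑ m ∈ S, C m) * β ^ (∑ m ∈ S, (|q m| + |k m|)) * Real.sqrt ((lam1 / lam0) ^ (n + 1)) * lam0 ^ (n + 1) :=
        mul_le_mul_of_nonneg_right hstep hpow0.le
    _ ≤ (1 + (∑ m ∈ S, C m) * β ^ (∑ m ∈ S, (|q m| + |k m|)) * Real.sqrt ((lam1 / lam0) ^ (n + 1))) * lam0 ^ (n + 1) := by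
        nlinarith

end Summit.QuantumFields.YangMills.Theorems.AspectPurityFloor

end
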